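import Literature.MathematicalPhysics.QuantumFieldTheory.Balaban1983to89.B9Thm311PosViaLocalFamilyY
import Literature.MathematicalPhysics.QuantumFieldTheory.Balaban1983to89.B9Thm39CubeOpsAtLettersY
import Literature.MathematicalPhysics.QuantumFieldTheory.Balaban1983to89.Node00.OpsYDeltaALocal

/-!
# `Balaban1983to89.B9Thm311PosViaDeltaALocalY` — [B9] THEOREM 3.11 FOR `Δ_a` BY PRINT's ROAD VERBATIM at def-Y's letters: the row-17 face of the N06
# certificate with print's LOCAL operators `Δ_{a,□}(U) = Δ(U) + D_U R_□(U) D*_U + Q*aQ` (def-Y's `deltaALocY`, local gauge projection `RlocY`) and their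
# padded bond inverses `G_□(U)` (`GAsqY`): `hΔA(U)` from (i) positivity of every compressed `Δ_{a,□}(U)` (Cor. 3.6 for the local operators) and (ii) the
# form-smallness of (3.105)'s remainder, whose summands are the COMMUTATOR `[h_□, Δ_a]` plus print's DEFECT `h_□·D(R_□ − R)D*`, read against `G_□h_□`

statement-level skeleton of published theorems with citation tags; proofs where landed; nothing here is a claim about the
Yang–Mills mass gap

T. Bałaban, *Propagators for lattice gauge theories in a background field*, Commun. Math. Phys. **99** (1985) 389–434
[`Balaban1985BackgroundPropagators`, "[B9]"].  PDF held (`paper:balaban1985-cmp99-background-propagators`, journal page = PDF page + 388); pp. 414–416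
re-read by this seat (2026-08-28).

THE PRINT (verbatim).  p. 414, (3.105): *«Δ_aG₀ = I − Σ_□ K(h_□)G_□h_□ + Σ_□ ζ_□(DPD* − DP_□D*)h_□G_□h_□ + … = I − R»*, (3.106): *«G = G₀(I − R)⁻¹»*; p. 416: *«Thus we have to
prove the positivity of G₀. By the definition (3.87) it is enough to prove a positivity of the operators G_□ … In [4] we have proved that the operator G_□(1) is
positive, hence by the same reasoning as above we prove positivity of G_□.»*

WHY THIS FILE (cell context, pub-ymgap N06 DAG).  This lineage's p606819 typed the p. 416 road for row 17 with the local operators taken as Dirichlet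
COMPRESSIONS of the full `Δ_a(U)`; the discharge referee (ref-A g28 READ-2) registered WATCH-ROW17-LOCALISATION-MISMATCH — print's local operators carry the
LOCAL gauge projection `R_□`.  p613605 re-typed the road for an ARBITRARY local family, and node00-def-Y's FILE 40 `Node00.OpsYDeltaALocal` (2026-08-28) typed
print's local letters at W-a's instance: `ClocY` (padded local `C_□`), `PlocY ∕ RlocY` (`R_□ = I − G′_□Q′*C_□Q′G′_□`), `deltaALocY` (`Δ_{a,□}`), `padDeltaALocY`,
`GAsqY` (`G_□`), with the defect identity `deltaALocY_sub_deltaAY : Δ_{a,□} − Δ_a = D_U(R_□ − R)D*_U`.  This file is the one-step INSTANCE: p613605 at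
`Tloc c := deltaALocY … (D c) (M_{𝟙_{Dblk c}}) U` — the certificate's `hΔA(U)` from exactly print's two inputs, the positivity of the local `G_□`'s operators and
the smallness of (3.105)'s `R`, and the remainder's summands identified as commutator + print's defect.

WHAT IS PROVED (sorry-free; 0 `def`).
* `remainder_summand_eq_commutator_add_defect`: `M_h·Δ_{a,□}(U) − Δ_a(U)·M_h = (M_h·Δ_a(U) − Δ_a(U)·M_h) + M_h·D_U(R_□(U) − R(U))D*_U` (def-Y's `deltaALocY_eq_deltaAY_add`).
* ★★★ `deltaAY_parSymY_posDefTr_of_deltaALoc`: for `G ≤ U(N)`, a `G`-valued `U`, cubes `(D c, Dblk c)` with bond cut-offs `χ c` (0∕1) and partition `h_c`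
  (`Σ_c h_c² = 1`, `supp h_c ⊆ {χ_c = 1}`): `PosDefTr 1 (deltaAY i (parSymY i) (parBY i) (GpY i (parSymY i)) U)` ⇐ (i) `∀ c, PosDefTr 1 (padDeltaALocY i (parSymY i)
  (parBY i) (D c) (M_{𝟙_{Dblk c}}) (M_{χ_c}) U)` and (ii) `⟨A, R(U)A⟩₁ ≤ θ⟨A, A⟩₁`, `θ < 1`, for
  `R(U) = Σ_c (M_{h_c}·Δ_{a,□_c}(U) − Δ_a(U)·M_{h_c})·G_{□_c}(U)·M_{h_c}` (`G_{□_c}(U) = GAsqY … (D c) (M_{𝟙_{Dblk c}}) (M_{χ_c}) U`);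
  `isUnit_deltaAY_parSymY_of_deltaALoc`, `GAY_parSymY_posDefTr_of_deltaALoc`.

HONEST SCOPE.  The two inputs are the analytic content of Theorem 3.11 for `Δ_a` ON PRINT's ROAD and stay HYPOTHESES: (i) = Cor. 3.6's positivity for the
local operators (print p. 416: «G_□(e^{iηA}) = G_□(1)(I − V(A)G_□(1))⁻¹ … G_□(1) is positive»), (ii) = «R is an operator with small norm» ((3.105)'s estimates,
Thm 3.10's (3.89)-type bounds incl. the defect `D(P − P_□)D*` controlled by Thms 3.1–3.2), here in L²-form currency.  The cubes, cut-offs and partition are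
parameters (W-a's letters instantiate them).  `𝔸 = M_N(ℂ)`.  Count-neutral (no new named fact; N06 NOT discharged; `hΔA` stays displayed until the knit decides
otherwise); nothing continuum, nothing about OS axioms or the mass gap.  No `sorry`, no `axiom`, no `instance`, no `notation`.  Seat `pub-ymgap-dag-n06-j` (bundle
F5, rows 15–17), gen 20, 2026-08-28; NEW file; imports p613605, p608171 (`blkIndY`) and node00-def-Y's `Node00.OpsYDeltaALocal`; modifies nothing.
-/

noncomputable section

namespace Literature.MathematicalPhysics.QuantumFieldTheory.Balaban1983to89.B9Thm311PosViaDeltaALocalY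

open B9Thm311ReadingCoords B9Thm311DeltaPrimePos B9Thm311LocalInversePosY B9Thm311PosViaLocalInversesY B9Thm311PosViaLocalFamilyY
  B9Thm39CubeOpsAtLettersY Node00 Node00.OpsYLocalInverse Node00.OpsYDeltaALocal
open B9Thm37CubeCoverCommutators (cutMulY cutMulY_apply cutMulY_mul cutMulY_one)
open B6KLevelCensusIndexV1 (KIdx)
open scoped Matrix Matrix.Norms.L2Operator

variable {d ℓ : ℕ} {hd : 1 ≤ d + 1} {hL : Odd (ℓ + 1) ∧ 1 < ℓ + 1} {b₀ b₁ : ℝ} {N : ℕ}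
variable (i : KIdx d ℓ hd hL b₀ b₁) {G : Subgroup (Matrix (Fin N) (Fin N) ℂ)ˣ}

/-- **the summand of (3.105)'s remainder = COMMUTATOR + print's DEFECT**: `M_h·Δ_{a,□}(U) − Δ_a(U)·M_h = (M_h·Δ_a(U) − Δ_a(U)·M_h) + M_h·D_U(R_□(U) − R(U))D*_U`.
[cite: Balaban1985BackgroundPropagators, (3.105) p.414 («− Σ K(h_□)G_□h_□ + Σ ζ_□(DPD* − DP_□D*)h_□G_□h_□»)] -/
theorem remainder_summand_eq_commutator_add_defect (parS : SiteParY (Matrix (Fin N) (Fin N) ℂ) i) (parB : BondParY (Matrix (Fin N) (Fin N) ℂ) i)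
    (Gp : SiteOpY (Matrix (Fin N) (Fin N) ℂ) i) (D : Finset (SiteY i)) (P : Module.End ℂ (BlkY i → Matrix (Fin N) (Fin N) ℂ))
    (U : CfgY (Matrix (Fin N) (Fin N) ℂ) i) (h : FBondY i → ℝ) :
    cutMulY h * deltaALocY i parS parB D P U - deltaAY i parS parB Gp U * cutMulY h
      = (cutMulY h * deltaAY i parS parB Gp U - deltaAY i parS parB Gp U * cutMulY h)
        + cutMulY h * (gradY i U ∘ₗ (RlocY i parS D P U - RY i parS Gp U) ∘ₗ divY i U) := by
  rw [deltaALocY_eq_deltaAY_add i parS parB D P Gp U, mul_add]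
  abel

/-- ★★★ **ROW 17 BY PRINT's ROAD VERBATIM**: for `G ≤ U(N)` and a `G`-valued `U`, the certificate's `PosDefTr 1 (Δ_a(U))` follows from
(i) positivity of every padded compression of print's LOCAL operator `Δ_{a,□}(U)` to the cube's bonds (Cor. 3.6 for the local operators) and
(ii) the L²-form smallness of (3.105)'s remainder `R(U) = Σ_c (M_{h_c}·Δ_{a,□_c}(U) − Δ_a(U)·M_{h_c})·G_{□_c}(U)·M_{h_c}` — and NOTHING ELSE.
[cite: Balaban1985BackgroundPropagators, Thm 3.11 p.416, (3.105)–(3.106) p.414, (3.87) p.409] -/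
theorem deltaAY_parSymY_posDefTr_of_deltaALoc (hG : G ≤ B7Prop2Explicit.unitaryUnits (Matrix (Fin N) (Fin N) ℂ))
    {U : CfgY (Matrix (Fin N) (Fin N) ℂ) i} (hU : ∀ μ x, U μ x ∈ G) {ι : Type} [Fintype ι]
    (D : ι → Finset (SiteY i)) (Dblk : ι → Finset (BlkY i))
    (hf : ι → FBondY i → ℝ) (hsq : ∀ b, ∑ c, hf c b ^ 2 = 1) (χ : ι → FBondY i → ℝ) (hχ : ∀ c b, χ c b = 0 ∨ χ c b = 1)
    (hsupp : ∀ c b, hf c b ≠ 0 → χ c b = 1)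
    (hloc : ∀ c, PosDefTr (fun _ => (1 : ℝ))
      (padDeltaALocY i (parSymY i) (parBY i) (D c) (cutMulY (blkIndY i (Dblk c))) (cutMulY (χ c)) U))
    {θ : ℝ} (hθ : θ < 1)
    (hsmall : ∀ A : FBondY i → Matrix (Fin N) (Fin N) ℂ,
      trIP (fun _ => (1 : ℝ)) A ((∑ c,
          (cutMulY (hf c) * deltaALocY i (parSymY i) (parBY i) (D c) (cutMulY (blkIndY i (Dblk c))) U
            - deltaAY i (parSymY i) (parBY i) (GpY i (parSymY i)) U * cutMulY (hf c))
          * GAsqY i (parSymY i) (parBY i) (D c) (cutMulY (blkIndY i (Dblk c))) (cutMulY (χ c)) U * cutMulY (hf c) :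
        Module.End ℂ (FBondY i → Matrix (Fin N) (Fin N) ℂ)) A) ≤ θ * trIP (fun _ => (1 : ℝ)) A A) :
    PosDefTr (fun _ => (1 : ℝ)) (deltaAY i (parSymY i) (parBY i) (GpY i (parSymY i)) U) :=
  deltaAY_parSymY_posDefTr_of_localFamily i hG hU
    (fun c => deltaALocY i (parSymY i) (parBY i) (D c) (cutMulY (blkIndY i (Dblk c))) U) hf hsq χ hχ hsupp hloc hθ hsmall

/-- hence `Δ_a(U)` is a unit, on print's two inputs. [cite: Balaban1985BackgroundPropagators, (3.27) p.395, Thm 3.11 p.416] -/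
theorem isUnit_deltaAY_parSymY_of_deltaALoc (hG : G ≤ B7Prop2Explicit.unitaryUnits (Matrix (Fin N) (Fin N) ℂ))
    {U : CfgY (Matrix (Fin N) (Fin N) ℂ) i} (hU : ∀ μ x, U μ x ∈ G) {ι : Type} [Fintype ι]
    (D : ι → Finset (SiteY i)) (Dblk : ι → Finset (BlkY i))
    (hf : ι → FBondY i → ℝ) (hsq : ∀ b, ∑ c, hf c b ^ 2 = 1) (χ : ι → FBondY i → ℝ) (hχ : ∀ c b, χ c b = 0 ∨ χ c b = 1)
    (hsupp : ∀ c b, hf c b ≠ 0 → χ c b = 1)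
    (hloc : ∀ c, PosDefTr (fun _ => (1 : ℝ))
      (padDeltaALocY i (parSymY i) (parBY i) (D c) (cutMulY (blkIndY i (Dblk c))) (cutMulY (χ c)) U))
    {θ : ℝ} (hθ : θ < 1)
    (hsmall : ∀ A : FBondY i → Matrix (Fin N) (Fin N) ℂ,
      trIP (fun _ => (1 : ℝ)) A ((∑ c,
          (cutMulY (hf c) * deltaALocY i (parSymY i) (parBY i) (D c) (cutMulY (blkIndY i (Dblk c))) U
            - deltaAY i (parSymY i) (parBY i) (GpY i (parSymY i)) U * cutMulY (hf c))
          * GAsqY i (parSymY i) (parBY i) (D c) (cutMulY (blkIndY i (Dblk c))) (cutMulY (χ c)) U * cutMulY (hf c) :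
        Module.End ℂ (FBondY i → Matrix (Fin N) (Fin N) ℂ)) A) ≤ θ * trIP (fun _ => (1 : ℝ)) A A) :
    IsUnit (deltaAY i (parSymY i) (parBY i) (GpY i (parSymY i)) U) :=
  isUnit_of_posDefTr (deltaAY_parSymY_posDefTr_of_deltaALoc i hG hU D Dblk hf hsq χ hχ hsupp hloc hθ hsmall)

/-- and `G(U) = Δ_a(U)⁻¹` (def-Y's `GAY`) is positive definite on print's two inputs — Theorem 3.11's «it is enough to prove it for G».
[cite: Balaban1985BackgroundPropagators, Thm 3.11 p.416, (3.27) p.395] -/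
theorem GAY_parSymY_posDefTr_of_deltaALoc (hG : G ≤ B7Prop2Explicit.unitaryUnits (Matrix (Fin N) (Fin N) ℂ))
    {U : CfgY (Matrix (Fin N) (Fin N) ℂ) i} (hU : ∀ μ x, U μ x ∈ G) {ι : Type} [Fintype ι]
    (D : ι → Finset (SiteY i)) (Dblk : ι → Finset (BlkY i))
    (hf : ι → FBondY i → ℝ) (hsq : ∀ b, ∑ c, hf c b ^ 2 = 1) (χ : ι → FBondY i → ℝ) (hχ : ∀ c b, χ c b = 0 ∨ χ c b = 1)
    (hsupp : ∀ c b, hf c b ≠ 0 → χ c b = 1)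
    (hloc : ∀ c, PosDefTr (fun _ => (1 : ℝ))
      (padDeltaALocY i (parSymY i) (parBY i) (D c) (cutMulY (blkIndY i (Dblk c))) (cutMulY (χ c)) U))
    {θ : ℝ} (hθ : θ < 1)
    (hsmall : ∀ A : FBondY i → Matrix (Fin N) (Fin N) ℂ,
      trIP (fun _ => (1 : ℝ)) A ((∑ c,
          (cutMulY (hf c) * deltaALocY i (parSymY i) (parBY i) (D c) (cutMulY (blkIndY i (Dblk c))) U
            - deltaAY i (parSymY i) (parBY i) (GpY i (parSymY i)) U * cutMulY (hf c))
          * GAsqY i (parSymY i) (parBY i) (D c) (cutMulY (blkIndY i (Dblk c))) (cutMulY (χ c)) U * cutMulY (hf c) :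
        Module.End ℂ (FBondY i → Matrix (Fin N) (Fin N) ℂ)) A) ≤ θ * trIP (fun _ => (1 : ℝ)) A A) :
    PosDefTr (fun _ => (1 : ℝ)) (GAY i (parSymY i) (parBY i) (GpY i (parSymY i)) U) :=
  posDefTr_ringInverse (deltaAY_parSymY_posDefTr_of_deltaALoc i hG hU D Dblk hf hsq χ hχ hsupp hloc hθ hsmall)

end Literature.MathematicalPhysics.QuantumFieldTheory.Balaban1983to89.B9Thm311PosViaDeltaALocalY

end
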